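import Summits.SmoothPoincare4.SmoothPoincare4.Theorems.EntropyRungCompactShrinkerGapEinsteinEndgameKillingHopf
import Summits.SmoothPoincare4.SmoothPoincare4.Theses.EntropyRung
import Literature.Topology.FourManifolds.MorseTwoCriticalPoints
import Literature.Topology.FourManifolds.CerfGammaFour
import Literature.Topology.FourManifolds.ClosedBall
import HarnessLib

/-!
# The Morse door for `EntropyRung.CompactShrinkerGap` (crux stmt-SmoothPoincare4-10870), line cgy-variance-pivot

A curvature-free recogniser of `S⁴` through the POTENTIAL of the shrinker: if the potential `f`
of the normalised gradient shrinker is a Morse function with exactly two critical points, then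
`M = D⁴ ∪_φ D⁴` is a twisted sphere (Milnor, *Morse theory*, Thm. 4.1 and Remark — PROVED in the
tree, `IsMorse.exists_isTwistedSphere_of_ncard_criticalSet_eq_two`) and hence diffeomorphic to
`S⁴` by Cerf's `Γ₄ = 0` (named fact `cerf_twistedSphere_four`).  Together with the Einstein
endgame (`helper_einsteinEndgameKillingHopf`, Gursky 2000 + Killing–Hopf) this closes the crux
from the DICHOTOMY "Hess f ≡ 0 ∨ f is Morse with two critical points" (registered stub
`stub_morseDichotomy` of the lead's skeleton), a strictly weaker typing than STUB 26
(`stub_denseShrinkerIsEinstein`).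
-/

noncomputable section

set_option linter.dupNamespace false

open MeasureTheory Set Function
open scoped Manifold ContDiff ENNReal Topology ContinuousMap

namespace Summit.SmoothPoincare4.SmoothPoincare4.Theorems

open Literature.Geometry Literature.Geometry.Lorentzian Literature.Geometry.Riemannian
open Literature.Topology.FourManifolds

/-- **Reeb–Milnor–Cerf recogniser.** A closed smooth 4-manifold (summit binder) carrying a Morse
function with exactly two critical points is diffeomorphic to `S⁴`: it is a twisted sphere
`D⁴ ∪_φ D⁴` (Milnor 1963, Thm. 4.1 + Remark, proved in the tree) and every twisted 4-sphere is
standard (Cerf 1968, `Γ₄ = 0`, named fact). [cite: Milnor1963, Thm. 4.1 and Remark (p. 25)]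
[cite: Cerf1968, main theorem (Γ₄ = 0)] -/
theorem helper_diffeomorphSphere_of_morseTwoCriticalPoints :
    Literature.Topology.FourManifolds.cerf_twistedSphere_four →
    ∀ (M : Type) [TopologicalSpace M] [T2Space M] [SecondCountableTopology M]
      [ChartedSpace (EuclideanSpace ℝ (Fin 4)) M] [IsManifold (𝓡 4) ∞ M] [CompactSpace M] (f : M → ℝ),
      Literature.Topology.FourManifolds.IsMorse (𝓡 4) f →
      (Literature.Topology.FourManifolds.criticalSet (𝓡 4) f).ncard = 2 →
      Nonempty (M ≃ₘ⟮𝓡 4, 𝓡 4⟯ (Metric.sphere (0 : EuclideanSpace ℝ (Fin 5)) 1)) := by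
  intro hCerf M _ _ _ _ _ _ f hf h2
  obtain ⟨φ, hφ⟩ :=
    IsMorse.exists_isTwistedSphere_of_ncard_criticalSet_eq_two (k := 3) (by norm_num) hf h2
  exact hCerf φ { carrier := M, isTwistedSphere := hφ }

/-- **The Morse door (reduction).** Cerf's `Γ₄ = 0` and Gursky's Einstein gap turn the dichotomy
"for the crux data, `Hess f ≡ 0` or `f` is a Morse function with exactly two critical points"
into `EntropyRung.CompactShrinkerGap`: the Einstein branch is `helper_einsteinEndgameKillingHopf`
(Gursky 2000: `K ≡ 1/6` or `Vol ≤ 32π²`, the latter killed by the Jensen volume floor; Killing–Hopf),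
the Morse branch is `helper_diffeomorphSphere_of_morseTwoCriticalPoints` (Milnor 4.1 + Cerf).
[cite: Cerf1968, main theorem (Γ₄ = 0)] [cite: Gursky2000, Theorem 1] [cite: Milnor1963, Thm. 4.1] -/
theorem helper_morseDoorReduction :
    Literature.Topology.FourManifolds.cerf_twistedSphere_four →
    Literature.Geometry.Riemannian.gursky_einstein_homotopySphere_four →
    (∀ (M : Type) [TopologicalSpace M] [T2Space M] [SecondCountableTopology M]
      [ChartedSpace (EuclideanSpace ℝ (Fin 4)) M] [IsManifold (𝓡 4) ∞ M] [CompactSpace M]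
      [T3Space M] [MeasurableSpace M] [BorelSpace M],
      M ≃ₕ Metric.sphere (0 : EuclideanSpace ℝ (Fin 5)) 1 →
    ∀ (g : Literature.Geometry.Lorentzian.PseudoRiemannianMetric (𝓡 4) ∞ (EuclideanSpace ℝ (Fin 4))
        (TangentSpace (𝓡 4) : M → Type _)) [g.HasLeviCivita] (f : M → ℝ) (hg : g.IsRiemannian),
      ContMDiff (𝓡 4) 𝓘(ℝ, ℝ) ∞ f →
      (∀ (x : M) (X Y : TangentSpace (𝓡 4) x),
        g.ricci x X Y + g.hessian f x X Y = (1 / 2 : ℝ) * g.val x X Y) →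
      (∀ x : M, g.scalarCurvature x + g.gradSq f x = f x) →
      ENNReal.ofReal (32 * Real.pi ^ 2 * Real.sqrt Real.pi * Real.exp (-(3 : ℝ) / 2)) <
        ∫⁻ x, ENNReal.ofReal (Real.exp (-f x))
          ∂(Literature.Geometry.Lorentzian.riemannianMeasure (g.toContMDiffRiemannianMetric hg)) →
      (∀ (x : M) (X Y : TangentSpace (𝓡 4) x), g.hessian f x X Y = 0) ∨
        (Literature.Topology.FourManifolds.IsMorse (𝓡 4) f ∧
          (Literature.Topology.FourManifolds.criticalSet (𝓡 4) f).ncard = 2)) →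
    Summit.SmoothPoincare4.SmoothPoincare4.Theses.EntropyRung.CompactShrinkerGap := by
  intro hCerf hG hM M _ _ _ _ _ _ _ _ _ e g _ f hg hf hsol hnorm hdens
  rcases hM M e g f hg hf hsol hnorm hdens with hE | ⟨hMorse, h2⟩
  · exact helper_einsteinEndgameKillingHopf hG M e g f hg hf hsol hnorm hdens hE
  · exact helper_diffeomorphSphere_of_morseTwoCriticalPoints hCerf M f hMorse h2

end Summit.SmoothPoincare4.SmoothPoincare4.Theorems

end
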